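import Literature.AlgebraicGeometry.ShimuraVarieties.UnitaryShimuraCurveRecordComparison
import HarnessLib

/-!
# WEAK uniqueness of the canonical model of the unitary Shimura CURVE over an extension `E′ ⊇ L` of the reflex field
# ([Deligne 1979] 2.2.6 «at most one weakly canonical model over `E′`, `E(G,X) ⊂ E′ ⊂ ℂ`»; [Milne 2005] Thm. 13.6–13.7 (a), printed proof)

Topic `AlgebraicGeometry/ShimuraVarieties`, namespace `…ShimuraVarieties.UnitaryCanonicalModel` (sub-namespace `WeakRecordGS` for the
heads).  THEOREMS ONLY (no definition, no instance, no notation, no named fact, no `sorry`); sequel of ★ `UnitaryShimuraCurveRecordComparison`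
∕ ★ `UnitaryShimuraCurveRecordSystemUnique` (uniqueness over the reflex field `L` itself, [Milne 2005] Thm. 13.7).  Cell `hodgecm-mathlib`
(D-0151), programme P6 «MOD» (crux hLiu418 = stmt-HodgeConjecture-24832, `--supports`), GEN letter `stub_UNIQ` ∕ `stub_UNIF` of the P6a census.

WHY THE WEAK FORM.  The RSZ ∕ Kottwitz moduli scheme of the GEN∕REP letters lives over `𝒪_{Fᵢ}[1∕N]` with `Fᵢ ⊋ F` in general
(`Fᵢ ⊇` class fields attached to the auxiliary CM factor, [Liu2021] Lemma C.18, [RapoportSmithlingZhang2020Diagonal] §3.2), its generic fibre is an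
`Fᵢ`-scheme, and Shimura–Taniyama on the universal CM tuples gives reciprocity for `Aut(ℂ∕Fᵢ)` only; the identification GEN performs is therefore
`𝓜_η ≅ M⋆_{Kc} ⊗_F Fᵢ` OVER `Fᵢ` — uniqueness of the WEAKLY canonical model ([Deligne1979ShimuraVarieties] 2.2.6), not of the canonical one
(2.7.12).  The printed proof is the same (the density of ONE CM Hecke orbit, Lemma 13.5, needs no automorphism outside `Aut(ℂ∕E′)`; Prop. 13.1 needs
only `E′` countable), so this file re-runs ★ `UnitaryShimuraCurveRecordComparison` §2 with: base field `E′` (a number field with `L → E′`, `τ′ : E′ → ℂ`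
extending `τ`), ABSTRACT `E′`-schemes `Y`, `X` in place of the records՚ models, point bijections `ptsY : Y_{τ′}(ℂ) ≃ₜ Sh_K(ℂ)`,
`ptsX : X_{τ′}(ℂ) ≃ₜ Sh_{K′}(ℂ)` in place of (F2a), reciprocity clauses `recipY`, `recipX` quantified over `σ : ℂ ≃ₐ[E′] ℂ` in place of (F3), and
the complex comparison morphism `T_ℂ : Y_ℂ → X_ℂ` as a HYPOTHESIS (GEN՚s `stub_UNIF` supplies it from the moduli side; for two records it is ★
`RecordSystemGS.exists_heckeComplexTo`).  HONEST LABEL: HC_CM is proved only modulo the 2 remaining named inputs (hLiu418 24832, h413 24833) —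
behind them the booked printed statements + the MOD package — until rung 0 closes; this file is count-neutral capital.

* §0 `WeakRecordGS.exists_homeomorph_complexFibre` — `Y_ℂ(ℂ) ≃ₜ Sh_K(ℂ)` from `ptsY` (★ `AlgPoints.baseChangeEquiv`).
* §1 `lift_comp_left`, `map_conj_eq_map_of_recip`, `gal_comp` — `Aut(ℂ∕τ′E′)`-equivariance of `T_ℂ` from the weak reciprocity of BOTH sides;
  **`WeakRecordGS.exists_hom_of_complex`** — descent to an `E′`-morphism `Y ⟶ X` acting as `[v, aK] ↦ [v, agK′]`.
* §2 **`WeakRecordGS.hom_unique`** (an `E′`-morphism `Y ⟶ X` is determined by that action) and **`WeakRecordGS.exists_iso_of_complexIso`**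
  ([Deligne1979ShimuraVarieties] 2.2.6 at one level: a points-matching `ℂ`-ISOMORPHISM `Y_ℂ ≅ X_ℂ` descends to an `E′`-isomorphism `Y ≅ X`).

## References
* [Deligne1979ShimuraVarieties] P. Deligne, *Variétés de Shimura* (1979), 2.2.4–2.2.6 (PDF p. 29 of Milne's translation: «at most one weakly
  canonical model over `E` (for `E(G,X) ⊂ E ⊂ ℂ`)»), 2.7.12.
* [Milne2005ShimuraVarieties] J. S. Milne, *Introduction to Shimura varieties* (2005; held rev. 2017 `paper:url-b0e8e4ca1c12`), §13: Prop. 13.1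
  p. 117, Lemma 13.5, Thm. 13.6 p. 118, Thm. 13.7 (a) p. 119; Def. 12.8 (62) p. 114.
* [Liu2021] Y. Liu, *Fourier–Jacobi cycles and arithmetic relative trace formula*, Camb. J. Math. 9 (2021), Rem. C.2, Lemma C.18, proof of Prop. C.20.
-/

set_option autoImplicit false

noncomputable section

open Function MulAction Topology NumberField IsDedekindDomain CategoryTheory CategoryTheory.Limits Matrix
  AlgebraicGeometry Cardinal
open scoped Matrix ComplexOrder
open Literature.AlgebraicGeometry.Motives Literature.NumberTheory.Automorphic Literature.NumberTheory.Automorphic.UnitaryGroup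
open Literature.NumberTheory.Automorphic.Liu2021.AppendixC (C5.OpenCompactSubgroup C5.SmallLevel)
open Literature.NumberTheory.Automorphic.ShimuraDissection

namespace Literature.AlgebraicGeometry.ShimuraVarieties.UnitaryCanonicalModel

variable {L : Type} [Field L] [NumberField L] [IsCMField L] {Jstar : Matrix (Fin 2) (Fin 2) L} {τ : L →+* ℂ}
  {E : Type} [Field E] [NumberField E] [Algebra L E] {τE : E →+* ℂ}

/-! ### §0. The complex fibre of a weak model: the homeomorphism with `Sh_K(ℂ)` -/

omit [NumberField E] [Algebra L E] in
/-- For an `E′`-scheme `Y` with `ptsY : Y_{τ′}(ℂ) ≃ₜ Sh_K(ℂ)`: a homeomorphism `e : (Y ⊗_{E′,τ′} ℂ)(ℂ) ≃ₜ Sh_K(ℂ)` with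
`e⁻¹ [v, aK] = AlgPoints.baseChangeEquiv τ′ Y (ptsY⁻¹ [v, aK])` (weak form of ★ `RecordSystemGS.exists_homeomorph_complexFibre`; Conrad 2012
Prop. 2.1 ∕ 3.1). [cite: ConradAdelicPoints2012, Prop. 2.1 and Prop. 3.1] [cite: Milne2005ShimuraVarieties, Lemma 13.5 p. 118] -/
theorem WeakRecordGS.exists_homeomorph_complexFibre (K : Subgroup ↥(finAdelic (↥(maximalRealSubfield L)) L (IsCMField.complexConj L) 2 Jstar)) (Y : SchemeOver E)
    (ptsY : letI : Algebra E ℂ := τE.toAlgebra; ComplexPoints Y ≃ₜ ShimuraSetGS L Jstar τ K) :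
    ∃ e : (letI : Algebra E ℂ := τE.toAlgebra; ComplexPoints ((Motives.baseChangeHom τE).obj Y)) ≃ₜ ShimuraSetGS L Jstar τ K,
      ∀ (v : Fin 2 → ℂ) (hv : v ∈ negCone (Jstar.map τ)) (a : ↥(finAdelic (↥(maximalRealSubfield L)) L (IsCMField.complexConj L) 2 Jstar)),
        e.symm (ShimuraSetGS.mk L Jstar τ K v hv a) =
          (letI : Algebra E ℂ := τE.toAlgebra
           AlgPoints.baseChangeEquiv τE Y (ptsY.symm (ShimuraSetGS.mk L Jstar τ K v hv a))) := by
  letI : Algebra E ℂ := τE.toAlgebra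
  let b : ComplexPoints Y ≃ₜ ComplexPoints ((Motives.baseChangeHom τE).obj Y) :=
    Homeomorph.mk (AlgPoints.baseChangeEquiv τE Y) (AlgPoints.continuous_baseChangeEquiv τE Y)
      (AlgPoints.continuous_baseChangeEquiv_symm τE Y)
  exact ⟨b.symm.trans ptsY, fun v hv a => rfl⟩

/-! ### §1. [Deligne 1979] 2.2.6 ∕ [Milne 2005] Thm. 13.6: descent of a points-matching complex morphism between weak models -/

section Weak

variable (hτ : τE.comp (algebraMap L E) = τ) (K K' : Subgroup ↥(finAdelic (↥(maximalRealSubfield L)) L (IsCMField.complexConj L) 2 Jstar)) (X Y : SchemeOver E)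
  [SmoothOfRelativeDimension 1 Y.hom] (hX : IsProjectiveOver X)
  (ptsX : letI : Algebra E ℂ := τE.toAlgebra; ComplexPoints X ≃ₜ ShimuraSetGS L Jstar τ K')
  (ptsY : letI : Algebra E ℂ := τE.toAlgebra; ComplexPoints Y ≃ₜ ShimuraSetGS L Jstar τ K)
  (recipX : letI : Algebra E ℂ := τE.toAlgebra
    ∀ (σ : ℂ ≃ₐ[E] ℂ) (s : (FiniteAdeleRing (𝓞 L) L)ˣ), IsArtinCorrespondent L τ s σ.toRingEquiv →
      ∀ (w : Fin 2 → L) (hw : (fun i => τ (w i)) ∈ negCone (Jstar.map τ)) (d : ↥(finAdelic (↥(maximalRealSubfield L)) L (IsCMField.complexConj L) 2 Jstar)),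
        IsDiagTwistGS L Jstar w (recipFactor L s) d →
        ∀ a : ↥(finAdelic (↥(maximalRealSubfield L)) L (IsCMField.complexConj L) 2 Jstar), σ • ptsX.symm (ShimuraSetGS.mk L Jstar τ K' (fun i => τ (w i)) hw a) =
          ptsX.symm (ShimuraSetGS.mk L Jstar τ K' (fun i => τ (w i)) hw (d * a)))
  (recipY : letI : Algebra E ℂ := τE.toAlgebra
    ∀ (σ : ℂ ≃ₐ[E] ℂ) (s : (FiniteAdeleRing (𝓞 L) L)ˣ), IsArtinCorrespondent L τ s σ.toRingEquiv →
      ∀ (w : Fin 2 → L) (hw : (fun i => τ (w i)) ∈ negCone (Jstar.map τ)) (d : ↥(finAdelic (↥(maximalRealSubfield L)) L (IsCMField.complexConj L) 2 Jstar)),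
        IsDiagTwistGS L Jstar w (recipFactor L s) d →
        ∀ a : ↥(finAdelic (↥(maximalRealSubfield L)) L (IsCMField.complexConj L) 2 Jstar), σ • ptsY.symm (ShimuraSetGS.mk L Jstar τ K (fun i => τ (w i)) hw a) =
          ptsY.symm (ShimuraSetGS.mk L Jstar τ K (fun i => τ (w i)) hw (d * a)))
  (g : ↥(finAdelic (↥(maximalRealSubfield L)) L (IsCMField.complexConj L) 2 Jstar))
  (Tc : (Motives.baseChangeHom τE).obj Y ⟶ (Motives.baseChangeHom τE).obj X)
  (hTc : letI : Algebra E ℂ := τE.toAlgebra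
    ∀ (v : Fin 2 → ℂ) (hv : v ∈ negCone (Jstar.map τ)) (a : ↥(finAdelic (↥(maximalRealSubfield L)) L (IsCMField.complexConj L) 2 Jstar)),
      AlgPoints.map Tc (AlgPoints.baseChangeEquiv τE Y (ptsY.symm (ShimuraSetGS.mk L Jstar τ K v hv a))) =
      AlgPoints.baseChangeEquiv τE X (ptsX.symm (ShimuraSetGS.mk L Jstar τ K' v hv (a * g))))
  (t : letI : Algebra E ℂ := τE.toAlgebra; GaloisDescent.bc ℂ Y ⟶ GaloisDescent.bc ℂ X)
  (ht : letI : Algebra E ℂ := τE.toAlgebra; t = Tc.left)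

/-! `t` is `T_ℂ.left` read on the fibre products `X ×_L Spec ℂ` (`ht : t = T_ℂ.left`), as in the rank-3 file. -/

omit [NumberField E] [Algebra L E] [SmoothOfRelativeDimension 1 Y.hom] in
include hTc ht in
/-- The hypothesis «`T_ℂ` acts as `[v, aK] ↦ [v, agK']`» on underlying morphisms of the complex fibres:
`(P, 1) ≫ T_ℂ = (P', 1)` for `P = pts⁻¹[v, aK]`, `P' = pts⁻¹[v, agK']` (rank-2 twin of ★
`RecordSystem.lift_comp_heckeComplex_left`). [cite: Milne2005ShimuraVarieties, §13 p. 118 L21–26] -/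
theorem WeakRecordGS.lift_comp_left (v : Fin 2 → ℂ) (hv : v ∈ negCone (Jstar.map τ))
    (a : ↥(finAdelic (↥(maximalRealSubfield L)) L (IsCMField.complexConj L) 2 Jstar)) :
    letI : Algebra E ℂ := τE.toAlgebra
    pullback.lift (ptsY.symm (ShimuraSetGS.mk L Jstar τ K v hv a)).toSpecHom (𝟙 (Spec (.of ℂ)))
        (toSpecHom_comp_hom_eq (τ := τE) Y _) ≫ t =
      pullback.lift (ptsX.symm (ShimuraSetGS.mk L Jstar τ K' v hv (a * g))).toSpecHom (𝟙 (Spec (.of ℂ)))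
        (toSpecHom_comp_hom_eq (τ := τE) X _) := by
  letI : Algebra E ℂ := τE.toAlgebra
  have h : (AlgPoints.baseChangeEquiv τE Y (ptsY.symm (ShimuraSetGS.mk L Jstar τ K v hv a))).left ≫
      Tc.left = (AlgPoints.baseChangeEquiv τE X
        (ptsX.symm (ShimuraSetGS.mk L Jstar τ K' v hv (a * g)))).left :=
    congrArg (·.left) (hTc v hv a)
  rw [← lift_eq_baseChangeEquiv_left, ← lift_eq_baseChangeEquiv_left, ← ht] at h
  exact h

set_option maxHeartbeats 800000 in -- large adelic / Shimura-set terms: instance-heavy statements (as the rank-3 file)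
omit [NumberField E] [Algebra L E] [SmoothOfRelativeDimension 1 Y.hom] in
include hTc ht recipX recipY in
/-- **The conjugate `σ⁻¹(T_ℂ)` agrees with `T_ℂ` on the Hecke orbit of a special point** — the commutative square of
the proof of [Milne2005ShimuraVarieties] Thm. 13.6 (p. 118 L33–39), on the curve: for `σ ∈ Aut(ℂ/τL)`, Artin
correspondents `s` (for `σ`), `s'` (for `σ⁻¹`), twists `d = r_{x₀}(s)`, `d' = r_{x₀}(s')` at `x₀ = [τ w]` (`w ∈ L²`
negative at `τ`) and ANY `T'` with underlying morphism `(1 × Spec σ) ≫ T_ℂ ≫ (1 × Spec σ⁻¹)`: `T'(P) = T_ℂ(P)` for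
`P = pts⁻¹[x₀, aK]`, both being `pts⁻¹[x₀, agK']` by `recip` at `K` and `K'` (rank-2 twin of ★
`RecordSystem.map_conj_eq_map_of_recip`). [cite: Milne2005ShimuraVarieties, Thm. 13.6 p. 118 L29–39; Def. 12.8 (62) p. 114] -/
theorem WeakRecordGS.map_conj_eq_map_of_recip (σ : letI : Algebra E ℂ := τE.toAlgebra; ℂ ≃ₐ[E] ℂ)
    {w : Fin 2 → L} (hw : (fun i => τ (w i)) ∈ negCone (Jstar.map τ))
    {s s' : (FiniteAdeleRing (𝓞 L) L)ˣ}
    (hs : letI : Algebra E ℂ := τE.toAlgebra; IsArtinCorrespondent L τ s σ.toRingEquiv)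
    (hs' : letI : Algebra E ℂ := τE.toAlgebra; IsArtinCorrespondent L τ s' σ⁻¹.toRingEquiv)
    {d d' : ↥(finAdelic (↥(maximalRealSubfield L)) L (IsCMField.complexConj L) 2 Jstar)}
    (hd : IsDiagTwistGS L Jstar w (recipFactor L s) d) (hd' : IsDiagTwistGS L Jstar w (recipFactor L s') d')
    (T' : (Motives.baseChangeHom τE).obj Y ⟶ (Motives.baseChangeHom τE).obj X)
    (hT' : letI : Algebra E ℂ := τE.toAlgebra
      GaloisDescent.gal ℂ Y σ⁻¹ ≫ t ≫ GaloisDescent.gal ℂ X σ = T'.left)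
    (a : ↥(finAdelic (↥(maximalRealSubfield L)) L (IsCMField.complexConj L) 2 Jstar)) :
    letI : Algebra E ℂ := τE.toAlgebra
    AlgPoints.map T' (AlgPoints.baseChangeEquiv τE Y
        (ptsY.symm (ShimuraSetGS.mk L Jstar τ K (fun i => τ (w i)) hw a))) =
      AlgPoints.map Tc (AlgPoints.baseChangeEquiv τE Y
        (ptsY.symm (ShimuraSetGS.mk L Jstar τ K (fun i => τ (w i)) hw a))) := by
  letI : Algebra E ℂ := τE.toAlgebra
  -- reciprocity at the two levels
  have rK : ∀ b, σ⁻¹ • ptsY.symm (ShimuraSetGS.mk L Jstar τ K (fun i => τ (w i)) hw b) =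
      ptsY.symm (ShimuraSetGS.mk L Jstar τ K (fun i => τ (w i)) hw (d' * b)) :=
    recipY σ⁻¹ s' hs' w hw d' hd'
  have rK'σ : ∀ b, σ • ptsX.symm (ShimuraSetGS.mk L Jstar τ K' (fun i => τ (w i)) hw b) =
      ptsX.symm (ShimuraSetGS.mk L Jstar τ K' (fun i => τ (w i)) hw (d * b)) :=
    recipX σ s hs w hw d hd
  have rK' : ∀ b, σ⁻¹ • ptsX.symm (ShimuraSetGS.mk L Jstar τ K' (fun i => τ (w i)) hw b) =
      ptsX.symm (ShimuraSetGS.mk L Jstar τ K' (fun i => τ (w i)) hw (d' * b)) :=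
    recipX σ⁻¹ s' hs' w hw d' hd'
  have FT := WeakRecordGS.lift_comp_left K K' X Y ptsX ptsY g Tc hTc t ht
  set P := ptsY.symm (ShimuraSetGS.mk L Jstar τ K (fun i => τ (w i)) hw a) with hP
  apply Over.OverMorphism.ext
  change (AlgPoints.baseChangeEquiv τE Y P).left ≫ T'.left =
    (AlgPoints.baseChangeEquiv τE Y P).left ≫ Tc.left
  rw [← lift_eq_baseChangeEquiv_left, ← hT', ← ht]
  change pullback.lift P.toSpecHom (𝟙 (Spec (.of ℂ))) (toSpecHom_comp_hom_eq (τ := τE) Y P) ≫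
      (GaloisDescent.gal ℂ Y σ⁻¹ ≫ t ≫ GaloisDescent.gal ℂ X σ) =
    pullback.lift P.toSpecHom (𝟙 (Spec (.of ℂ))) (toSpecHom_comp_hom_eq (τ := τE) Y P) ≫ t
  -- move the point through `gal σ⁻¹`, apply `T_ℂ`, move through `gal σ`, using reciprocity twice
  have step1 : pullback.lift P.toSpecHom (𝟙 (Spec (.of ℂ))) (toSpecHom_comp_hom_eq (τ := τE) Y P) ≫
      GaloisDescent.gal ℂ Y σ⁻¹ =
      AbelianVariety.specAut ℂ σ ≫ pullback.lift (σ⁻¹ • P).toSpecHom (𝟙 (Spec (.of ℂ)))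
        (toSpecHom_comp_hom_eq (τ := τE) Y (σ⁻¹ • P)) := by
    have h := lift_comp_gal (τ := τE) Y σ⁻¹ P
    rw [inv_inv] at h
    exact h
  rw [← Category.assoc, step1, Category.assoc, hP, rK a, ← Category.assoc (pullback.lift _ _ _),
    FT (fun i => τ (w i)) hw (d' * a), lift_comp_gal (τ := τE) X σ, rK'σ, ← Category.assoc,
    AbelianVariety.specAut_comp_specAut_symm, Category.id_comp, FT (fun i => τ (w i)) hw a]
  -- the two points of `M_{K'}(ℂ)` coincide: `[x₀, d d' a g K'] = [x₀, a g K']`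
  have hfix : ptsX.symm (ShimuraSetGS.mk L Jstar τ K' (fun i => τ (w i)) hw (d * (d' * a * g))) =
      ptsX.symm (ShimuraSetGS.mk L Jstar τ K' (fun i => τ (w i)) hw (a * g)) := by
    rw [mul_assoc d' a g, ← rK'σ, ← rK', smul_inv_smul]
  rw [hfix]

set_option maxHeartbeats 400000 in -- large adelic / Shimura-set terms: instance-heavy statements (as the rank-3 file)
omit [NumberField E] in
include hTc ht recipX recipY hX hτ in
/-- **`σ(T_ℂ) = T_ℂ`** ([Milne2005ShimuraVarieties] Thm. 13.6, proof, p. 118 L29–41), on the curve: a `ℂ`-morphism of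
the complex fibres acting as `[v, aK] ↦ [v, agK']` commutes with `1 × Spec σ⁻¹`, `σ ∈ Aut(ℂ/τL)`. The conjugate is
a `ℂ`-morphism `T'`, and `ℂ`-morphisms out of the (reduced) complex fibre are determined by their complex points
(`SchemeOver.hom_ext_of_forall_algPoints`), read through `e : (M_K)_τ(ℂ) ≃ₜ Sh_K(ℂ)`. CASE SPLIT on the printed «let
`x₀ ∈ X` be special»: if the negative cone of `J⋆^τ` has a vector, a negative `L`-vector `w` is nearby
(`exists_embedding_mem_negCone`), `T'` agrees with `T_ℂ` on the Hecke orbit of `[τ w]` (`map_conj_eq_map_of_recip`)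
and that orbit is dense (Lemma 13.5 = ★ `ShimuraSetGS.eq_of_forall_mk_eq`); if it has none, `Sh_K(ℂ) = ∅` and the
extensionality is vacuous (rank-2 twin of ★ `RecordSystem.gal_comp_heckeComplex`).
[cite: Milne2005ShimuraVarieties, Thm. 13.6 p. 118 L29–41; Lemma 13.5 p. 118 L13–20] -/
theorem WeakRecordGS.gal_comp (hJ : (Jstar.map (IsCMField.complexConj L))ᵀ = Jstar)
    (hdet : IsUnit Jstar.det) (σ : letI : Algebra E ℂ := τE.toAlgebra; ℂ ≃ₐ[E] ℂ)
    (e : letI : Algebra E ℂ := τE.toAlgebra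
      ComplexPoints ((Motives.baseChangeHom τE).obj Y) ≃ₜ ShimuraSetGS L Jstar τ K)
    (he : letI : Algebra E ℂ := τE.toAlgebra
      ∀ (v : Fin 2 → ℂ) (hv : v ∈ negCone (Jstar.map τ))
        (a : ↥(finAdelic (↥(maximalRealSubfield L)) L (IsCMField.complexConj L) 2 Jstar)),
        e.symm (ShimuraSetGS.mk L Jstar τ K v hv a) =
          AlgPoints.baseChangeEquiv τE Y (ptsY.symm (ShimuraSetGS.mk L Jstar τ K v hv a))) :
    letI : Algebra E ℂ := τE.toAlgebra
    GaloisDescent.gal ℂ Y σ ≫ t = t ≫ GaloisDescent.gal ℂ X σ := by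
  letI : Algebra E ℂ := τE.toAlgebra
  letI : Algebra L ℂ := τ.toAlgebra
  haveI : IsScalarTower L E ℂ := IsScalarTower.of_algebraMap_eq fun x => (RingHom.congr_fun hτ x).symm
  -- instances on the complex fibres
  haveI : SmoothOfRelativeDimension 1 ((Motives.baseChangeHom τE).obj Y).hom :=
    HodgeTheory.smoothOfRelativeDimension_baseChangeHom_hom τE 1 Y
  haveI : Smooth ((Motives.baseChangeHom τE).obj Y).hom := SmoothOfRelativeDimension.smooth 1 _
  haveI : IsReduced ((Motives.baseChangeHom τE).obj Y).left :=
    isReduced_of_smooth_over_field ((Motives.baseChangeHom τE).obj Y).hom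
  haveI : IsProper ((Motives.baseChangeHom τE).obj X).hom := (hX.baseChange_obj ℂ).isProper
  haveI : T2Space (ComplexPoints ((Motives.baseChangeHom τE).obj X)) :=
    ComplexPoints.t2Space_of_isSeparated _
  -- `T_ℂ` is a morphism over `ℂ`
  have hTsnd : t ≫ pullback.snd X.hom (AbelianVariety.bcSpec E ℂ) =
      pullback.snd Y.hom (AbelianVariety.bcSpec E ℂ) := by
    rw [ht]
    exact Over.w Tc
  -- the conjugate morphism `gal σ⁻¹ ≫ T_ℂ ≫ gal σ`, a morphism OVER `ℂ`
  have hw : (GaloisDescent.gal ℂ Y σ⁻¹ ≫ t ≫ GaloisDescent.gal ℂ X σ) ≫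
      pullback.snd X.hom (AbelianVariety.bcSpec E ℂ) = pullback.snd Y.hom (AbelianVariety.bcSpec E ℂ) := by
    rw [Category.assoc, Category.assoc, GaloisDescent.gal_snd, ← Category.assoc t, hTsnd,
      GaloisDescent.gal_snd_assoc, inv_inv, AbelianVariety.specAut_comp_specAut_symm, Category.comp_id]
  let T' : (Motives.baseChangeHom τE).obj Y ⟶ (Motives.baseChangeHom τE).obj X :=
    Over.homMk (GaloisDescent.gal ℂ Y σ⁻¹ ≫ t ≫ GaloisDescent.gal ℂ X σ) hw
  have hT' : GaloisDescent.gal ℂ Y σ⁻¹ ≫ t ≫ GaloisDescent.gal ℂ X σ = T'.left := rfl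
  -- `T' = T_ℂ`: case split on the existence of a special point
  have hT'T : T' = Tc := by
    by_cases hne : ∃ v : Fin 2 → ℂ, v ∈ negCone (Jstar.map τ)
    · -- a special point `[τ w]`, `w ∈ L²` negative at `τ`
      obtain ⟨v, hv⟩ := hne
      obtain ⟨w, hw0⟩ := exists_embedding_mem_negCone Jstar τ hv
      have hww : hermForm (cmConjRingHom L) Jstar w w ≠ 0 := hermForm_self_ne_zero_of_embedding_mem_negCone hw0
      -- Artin data and reciprocity twists for `σ` and `σ⁻¹`
      refine (exists_finiteIdele_isArtinCorrespondent_algEquiv L τ (σ.restrictScalars L)).elim fun s hs => ?_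
      refine (exists_finiteIdele_isArtinCorrespondent_algEquiv L τ (σ⁻¹.restrictScalars L)).elim fun s' hs' => ?_
      refine (exists_isDiagTwistGS_recipFactor' L Jstar hJ hww s).elim fun d hd => ?_
      refine (exists_isDiagTwistGS_recipFactor' L Jstar hJ hww s').elim fun d' hd' => ?_
      have hs0 : IsArtinCorrespondent L τ s σ.toRingEquiv := hs
      have hs'0 : IsArtinCorrespondent L τ s' σ⁻¹.toRingEquiv := hs'
      -- `T'` and `T_ℂ` agree on the Hecke orbit of `[τ w]`, hence everywhere (density, Lemma 13.5)
      have horbit : ∀ a : ↥(finAdelic (↥(maximalRealSubfield L)) L (IsCMField.complexConj L) 2 Jstar),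
          AlgPoints.map T' (e.symm (ShimuraSetGS.mk L Jstar τ K (fun i => τ (w i)) hw0 a)) =
            AlgPoints.map Tc (e.symm (ShimuraSetGS.mk L Jstar τ K (fun i => τ (w i)) hw0 a)) := by
        intro a
        rw [he]
        exact WeakRecordGS.map_conj_eq_map_of_recip K K' X Y ptsX ptsY recipX recipY g Tc hTc t ht σ hw0 hs0 hs'0 hd hd' T' hT' a
      have hfun : (fun p => AlgPoints.map T' (e.symm p)) = fun p => AlgPoints.map Tc (e.symm p) :=
        ShimuraSetGS.eq_of_forall_mk_eq L Jstar τ K hJ hdet hw0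
          ((AlgPoints.continuous_map T').comp e.symm.continuous)
          ((AlgPoints.continuous_map Tc).comp e.symm.continuous) horbit
      refine SchemeOver.hom_ext_of_forall_algPoints ℂ fun P => ?_
      have h := congrFun hfun (e P)
      simp only [Homeomorph.symm_apply_apply, AlgPoints.map_apply] at h
      exact h
    · -- no special point: `Sh_K(ℂ) = ∅`, so the complex fibre has no complex point
      refine SchemeOver.hom_ext_of_forall_algPoints ℂ fun P => ?_
      obtain ⟨v, hv, a, -⟩ := ShimuraSetGS.mk_surjective L Jstar τ K (e P)
      exact absurd ⟨v, hv⟩ hne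
  -- unwind: `gal σ⁻¹ ≫ t ≫ gal σ = t`
  have hconj : GaloisDescent.gal ℂ Y σ⁻¹ ≫ t ≫ GaloisDescent.gal ℂ X σ = t := by
    have h := congrArg (·.left) hT'T
    rw [← hT', ← ht] at h
    exact h
  have h := congrArg (GaloisDescent.gal ℂ Y σ ≫ ·) hconj
  simp only [GaloisDescent.gal_comp_gal_symm_assoc] at h
  exact h.symm

omit t ht

set_option maxHeartbeats 400000 in -- large adelic / Shimura-set terms: instance-heavy statements (as the rank-3 file)
include hTc recipX recipY hX hτ in
/-- **[Milne2005ShimuraVarieties] THEOREM 13.6 for the CURVE record, by its printed proof**: for a record system `S`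
of the canonical model of `Sh(U(J⋆), 𝔻)` over `L` (along `τ`), `J⋆` non-degenerate `c`-hermitian, small levels
`K, K' ≤ K₀` and `g ∈ U(J⋆)(𝔸_{L⁺,f})`: if SOME `ℂ`-morphism `T_ℂ : (M_K)_τ → (M_{K'})_τ` acts on complex points as
`[v, aK] ↦ [v, agK']` (read through `pts` and ★ `AlgPoints.baseChangeEquiv τ`), then ★ `S.IsHeckeTranslate K K' g T_g`
for some `L`-morphism `T_g` — `T_ℂ` is `Aut(ℂ/τL)`-equivariant (`gal_comp_heckeComplex`) and descends by Prop. 13.1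
(★ `GaloisDescent.existsUnique_map_eq_complex`, `L` countable); rank-2 twin of ★
`RecordSystem.exists_heckeTranslate_of_complex`. [cite: Milne2005ShimuraVarieties, Thm. 13.6 p. 118 L21–41; Prop. 13.1 p. 117 L5–13]
[cite: Deligne1979ShimuraVarieties, 2.2.4–2.2.5] -/
theorem WeakRecordGS.exists_hom_of_complex (hJ : (Jstar.map (IsCMField.complexConj L))ᵀ = Jstar)
    (hdet : IsUnit Jstar.det) :
    letI : Algebra E ℂ := τE.toAlgebra
    ∃ Tg : Y ⟶ X,
      ∀ (v : Fin 2 → ℂ) (hv : v ∈ negCone (Jstar.map τ))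
        (a : ↥(finAdelic (↥(maximalRealSubfield L)) L (IsCMField.complexConj L) 2 Jstar)),
        ptsX (AlgPoints.map Tg (ptsY.symm (ShimuraSetGS.mk L Jstar τ K v hv a))) =
          ShimuraSetGS.mk L Jstar τ K' v hv (a * g) := by
  letI : Algebra E ℂ := τE.toAlgebra
  -- instances on the complex fibres
  haveI : SmoothOfRelativeDimension 1 ((Motives.baseChangeHom τE).obj Y).hom :=
    HodgeTheory.smoothOfRelativeDimension_baseChangeHom_hom τE 1 Y
  haveI : Smooth ((Motives.baseChangeHom τE).obj Y).hom := SmoothOfRelativeDimension.smooth 1 _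
  haveI hXred : IsReduced ((Motives.baseChangeHom τE).obj Y).left :=
    isReduced_of_smooth_over_field ((Motives.baseChangeHom τE).obj Y).hom
  haveI : IsReduced (GaloisDescent.bc ℂ Y) := hXred
  haveI : IsProper X.hom := hX.isProper
  -- the homeomorphism of the record's normalisation
  obtain ⟨eK, heK⟩ := WeakRecordGS.exists_homeomorph_complexFibre K Y ptsY
  -- equivariance, for every `σ`
  have hequiv : ∀ σ : ℂ ≃ₐ[E] ℂ, GaloisDescent.gal ℂ Y σ ≫ Tc.left =
      Tc.left ≫ GaloisDescent.gal ℂ X σ := fun σ =>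
    WeakRecordGS.gal_comp hτ K K' X Y hX ptsX ptsY recipX recipY g Tc hTc Tc.left rfl hJ hdet σ eK heK
  -- DESCENT (Prop. 13.1): `T_ℂ` is the base change of an `L`-morphism `f`
  have hL : #E ≤ ℵ₀ := by
    refine (Algebra.IsAlgebraic.cardinalMk_le_max ℚ E).trans ?_
    rw [Cardinal.mkRat, max_self]
  refine (GaloisDescent.existsUnique_map_eq_complex (K := E) (X := Y) (Y := X) hL Tc
    (fun σ => hequiv σ)).exists.elim fun f hf => ?_
  refine ⟨f, fun v hv a => ?_⟩
  -- POINTS: `f` acts as `[v, aK] ↦ [v, agK']`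
  suffices hmap : AlgPoints.map f (ptsY.symm (ShimuraSetGS.mk L Jstar τ K v hv a)) =
      ptsX.symm (ShimuraSetGS.mk L Jstar τ K' v hv (a * g)) by
    rw [hmap, Homeomorph.apply_symm_apply]
  apply eq_of_lift_eq (τ := τE) X
  rw [← WeakRecordGS.lift_comp_left K K' X Y ptsX ptsY g Tc hTc Tc.left rfl v hv a]
  -- the base change of `f` on the fibre product: `(pr₁ ≫ f, pr₂)`
  have hfl : ((AbelianVariety.bcFunctor E ℂ).map f).left =
      pullback.lift (pullback.fst Y.hom (AbelianVariety.bcSpec E ℂ) ≫ f.left)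
        (pullback.snd Y.hom (AbelianVariety.bcSpec E ℂ))
        (by rw [Category.assoc, Over.w f]; exact pullback.condition) :=
    Over.pullback_map_left _ _
  have key : (pullback.lift (ptsY.symm (ShimuraSetGS.mk L Jstar τ K v hv a)).toSpecHom (𝟙 (Spec (.of ℂ)))
        (toSpecHom_comp_hom_eq (τ := τE) Y _) ≫ Tc.left :
        Spec (.of ℂ) ⟶ GaloisDescent.bc ℂ X) =
      pullback.lift (ptsY.symm (ShimuraSetGS.mk L Jstar τ K v hv a)).toSpecHom (𝟙 (Spec (.of ℂ)))
        (toSpecHom_comp_hom_eq (τ := τE) Y _) ≫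
      pullback.lift (pullback.fst Y.hom (AbelianVariety.bcSpec E ℂ) ≫ f.left)
        (pullback.snd Y.hom (AbelianVariety.bcSpec E ℂ))
        (by rw [Category.assoc, Over.w f]; exact pullback.condition) := by
    rw [← hfl, ← hf]
  rw [key]
  apply pullback.hom_ext
  · simp only [Category.assoc, pullback.lift_fst, pullback.lift_fst_assoc]
    rfl
  · simp only [Category.assoc, pullback.lift_snd]


end Weak

/-! ### §2. Uniqueness of points-matching morphisms; [Deligne 1979] 2.2.6 at one level (descent of a complex ISOMORPHISM) -/

omit [NumberField E] [Algebra L E] in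
/-- **An `E′`-morphism `Y ⟶ X` between weak models is determined by its action `[v, aK] ↦ [v, agK′]` on complex points** (`Y` smooth ⇒
reduced and locally of finite type; `X` projective ⇒ separated; every complex point of `Y` is some `ptsY⁻¹[v, aK]`, ★ `ShimuraSetGS.mk_surjective`;
★ `SchemeOver.hom_ext_of_forall_algPoints`). [cite: Milne2005ShimuraVarieties, Prop. 13.1 ∕ Cor. 13.2 p. 117] -/
theorem WeakRecordGS.hom_unique (K K' : Subgroup ↥(finAdelic (↥(maximalRealSubfield L)) L (IsCMField.complexConj L) 2 Jstar)) (X Y : SchemeOver E) [SmoothOfRelativeDimension 1 Y.hom] (hX : IsProjectiveOver X)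
    (ptsX : letI : Algebra E ℂ := τE.toAlgebra; ComplexPoints X ≃ₜ ShimuraSetGS L Jstar τ K')
    (ptsY : letI : Algebra E ℂ := τE.toAlgebra; ComplexPoints Y ≃ₜ ShimuraSetGS L Jstar τ K) (g : ↥(finAdelic (↥(maximalRealSubfield L)) L (IsCMField.complexConj L) 2 Jstar)) {T₁ T₂ : Y ⟶ X}
    (h₁ : letI : Algebra E ℂ := τE.toAlgebra
      ∀ (v : Fin 2 → ℂ) (hv : v ∈ negCone (Jstar.map τ)) (a : ↥(finAdelic (↥(maximalRealSubfield L)) L (IsCMField.complexConj L) 2 Jstar)),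
        ptsX (AlgPoints.map T₁ (ptsY.symm (ShimuraSetGS.mk L Jstar τ K v hv a))) = ShimuraSetGS.mk L Jstar τ K' v hv (a * g))
    (h₂ : letI : Algebra E ℂ := τE.toAlgebra
      ∀ (v : Fin 2 → ℂ) (hv : v ∈ negCone (Jstar.map τ)) (a : ↥(finAdelic (↥(maximalRealSubfield L)) L (IsCMField.complexConj L) 2 Jstar)),
        ptsX (AlgPoints.map T₂ (ptsY.symm (ShimuraSetGS.mk L Jstar τ K v hv a))) = ShimuraSetGS.mk L Jstar τ K' v hv (a * g)) :
    T₁ = T₂ := by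
  letI : Algebra E ℂ := τE.toAlgebra
  haveI : Smooth Y.hom := SmoothOfRelativeDimension.smooth 1 Y.hom
  haveI : IsReduced Y.left := isReduced_of_smooth_over_field Y.hom
  haveI : IsProper X.hom := hX.isProper
  refine SchemeOver.hom_ext_of_forall_algPoints ℂ fun x => ?_
  obtain ⟨v, hv, a, hx⟩ := ShimuraSetGS.mk_surjective L Jstar τ K (ptsY x)
  have hx' : x = ptsY.symm (ShimuraSetGS.mk L Jstar τ K v hv a) := by
    rw [← Homeomorph.symm_apply_apply ptsY x, ← hx]
  subst hx'
  have h : AlgPoints.map T₁ (ptsY.symm (ShimuraSetGS.mk L Jstar τ K v hv a)) =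
      AlgPoints.map T₂ (ptsY.symm (ShimuraSetGS.mk L Jstar τ K v hv a)) :=
    ptsX.injective (by rw [h₁ v hv a, h₂ v hv a])
  simpa only [AlgPoints.map_apply] using h

set_option maxHeartbeats 400000 in -- large adelic / Shimura-set terms (as §1)
/-- **[Deligne1979ShimuraVarieties] 2.2.6 at one level — descent of a points-matching complex ISOMORPHISM between weak models**: with both `Y` and
`X` smooth of relative dimension `1` and projective over `E′`, weak reciprocity on both, and a `ℂ`-isomorphism `Y_ℂ ≅ X_ℂ` carrying
`ptsY⁻¹[v, aK]` to `ptsX⁻¹[v, aK]`, there is an `E′`-ISOMORPHISM `Y ≅ X` doing the same (its two halves from §1 at `g = 1`; the composites are the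
identities by `hom_unique`). [cite: Deligne1979ShimuraVarieties, 2.2.6 and 2.7.12] [cite: Milne2005ShimuraVarieties, Thm. 13.7 (a) p. 119 L6–14; Cor. 13.2 p. 117] -/
theorem WeakRecordGS.exists_iso_of_complexIso (hτ : τE.comp (algebraMap L E) = τ) (K : Subgroup ↥(finAdelic (↥(maximalRealSubfield L)) L (IsCMField.complexConj L) 2 Jstar)) (X Y : SchemeOver E)
    [SmoothOfRelativeDimension 1 X.hom] [SmoothOfRelativeDimension 1 Y.hom] (hX : IsProjectiveOver X) (hY : IsProjectiveOver Y)
    (ptsX : letI : Algebra E ℂ := τE.toAlgebra; ComplexPoints X ≃ₜ ShimuraSetGS L Jstar τ K)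
    (ptsY : letI : Algebra E ℂ := τE.toAlgebra; ComplexPoints Y ≃ₜ ShimuraSetGS L Jstar τ K)
    (recipX : letI : Algebra E ℂ := τE.toAlgebra
      ∀ (σ : ℂ ≃ₐ[E] ℂ) (s : (FiniteAdeleRing (𝓞 L) L)ˣ), IsArtinCorrespondent L τ s σ.toRingEquiv →
        ∀ (w : Fin 2 → L) (hw : (fun i => τ (w i)) ∈ negCone (Jstar.map τ)) (d : ↥(finAdelic (↥(maximalRealSubfield L)) L (IsCMField.complexConj L) 2 Jstar)),
          IsDiagTwistGS L Jstar w (recipFactor L s) d →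
          ∀ a : ↥(finAdelic (↥(maximalRealSubfield L)) L (IsCMField.complexConj L) 2 Jstar), σ • ptsX.symm (ShimuraSetGS.mk L Jstar τ K (fun i => τ (w i)) hw a) =
            ptsX.symm (ShimuraSetGS.mk L Jstar τ K (fun i => τ (w i)) hw (d * a)))
    (recipY : letI : Algebra E ℂ := τE.toAlgebra
      ∀ (σ : ℂ ≃ₐ[E] ℂ) (s : (FiniteAdeleRing (𝓞 L) L)ˣ), IsArtinCorrespondent L τ s σ.toRingEquiv →
        ∀ (w : Fin 2 → L) (hw : (fun i => τ (w i)) ∈ negCone (Jstar.map τ)) (d : ↥(finAdelic (↥(maximalRealSubfield L)) L (IsCMField.complexConj L) 2 Jstar)),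
          IsDiagTwistGS L Jstar w (recipFactor L s) d →
          ∀ a : ↥(finAdelic (↥(maximalRealSubfield L)) L (IsCMField.complexConj L) 2 Jstar), σ • ptsY.symm (ShimuraSetGS.mk L Jstar τ K (fun i => τ (w i)) hw a) =
            ptsY.symm (ShimuraSetGS.mk L Jstar τ K (fun i => τ (w i)) hw (d * a)))
    (gc : (Motives.baseChangeHom τE).obj Y ≅ (Motives.baseChangeHom τE).obj X)
    (hgc : letI : Algebra E ℂ := τE.toAlgebra
      ∀ (v : Fin 2 → ℂ) (hv : v ∈ negCone (Jstar.map τ)) (a : ↥(finAdelic (↥(maximalRealSubfield L)) L (IsCMField.complexConj L) 2 Jstar)),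
        AlgPoints.map gc.hom (AlgPoints.baseChangeEquiv τE Y (ptsY.symm (ShimuraSetGS.mk L Jstar τ K v hv a))) =
        AlgPoints.baseChangeEquiv τE X (ptsX.symm (ShimuraSetGS.mk L Jstar τ K v hv a)))
    (hJ : (Jstar.map (IsCMField.complexConj L))ᵀ = Jstar) (hdet : IsUnit Jstar.det) :
    letI : Algebra E ℂ := τE.toAlgebra
    ∃ φ : Y ≅ X, ∀ (v : Fin 2 → ℂ) (hv : v ∈ negCone (Jstar.map τ)) (a : ↥(finAdelic (↥(maximalRealSubfield L)) L (IsCMField.complexConj L) 2 Jstar)),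
      ptsX (AlgPoints.map φ.hom (ptsY.symm (ShimuraSetGS.mk L Jstar τ K v hv a))) = ShimuraSetGS.mk L Jstar τ K v hv a := by
  letI : Algebra E ℂ := τE.toAlgebra
  -- the two halves act with `g = 1`
  have hgc1 : ∀ (v : Fin 2 → ℂ) (hv : v ∈ negCone (Jstar.map τ)) (a : ↥(finAdelic (↥(maximalRealSubfield L)) L (IsCMField.complexConj L) 2 Jstar)),
      AlgPoints.map gc.hom (AlgPoints.baseChangeEquiv τE Y (ptsY.symm (ShimuraSetGS.mk L Jstar τ K v hv a))) =
        AlgPoints.baseChangeEquiv τE X (ptsX.symm (ShimuraSetGS.mk L Jstar τ K v hv (a * 1))) := fun v hv a => by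
    rw [mul_one]; exact hgc v hv a
  have hgc2 : ∀ (v : Fin 2 → ℂ) (hv : v ∈ negCone (Jstar.map τ)) (a : ↥(finAdelic (↥(maximalRealSubfield L)) L (IsCMField.complexConj L) 2 Jstar)),
      AlgPoints.map gc.inv (AlgPoints.baseChangeEquiv τE X (ptsX.symm (ShimuraSetGS.mk L Jstar τ K v hv a))) =
        AlgPoints.baseChangeEquiv τE Y (ptsY.symm (ShimuraSetGS.mk L Jstar τ K v hv (a * 1))) := fun v hv a => by
    rw [mul_one, ← hgc v hv a, ← AlgPoints.map_comp_apply, Iso.hom_inv_id, AlgPoints.map_id_apply]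
  obtain ⟨f₁, hf₁⟩ := WeakRecordGS.exists_hom_of_complex hτ K K X Y hX ptsX ptsY recipX recipY 1 gc.hom hgc1 hJ hdet
  obtain ⟨f₂, hf₂⟩ := WeakRecordGS.exists_hom_of_complex hτ K K Y X hY ptsY ptsX recipY recipX 1 gc.inv hgc2 hJ hdet
  have h12 : f₁ ≫ f₂ = 𝟙 Y := by
    refine WeakRecordGS.hom_unique K K Y Y hY ptsY ptsY (1 * 1) (fun v hv a => ?_) (fun v hv a => ?_)
    · have e : AlgPoints.map (f₁ ≫ f₂) (ptsY.symm (ShimuraSetGS.mk L Jstar τ K v hv a)) =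
          AlgPoints.map f₂ (ptsX.symm (ShimuraSetGS.mk L Jstar τ K v hv (a * 1))) := by
        rw [← hf₁ v hv a, Homeomorph.symm_apply_apply]
        simp only [AlgPoints.map_apply, Category.assoc]
      rw [e, hf₂ v hv (a * 1), mul_assoc]
    · rw [AlgPoints.map_id_apply, Homeomorph.apply_symm_apply, mul_one, mul_one]
  have h21 : f₂ ≫ f₁ = 𝟙 X := by
    refine WeakRecordGS.hom_unique K K X X hX ptsX ptsX (1 * 1) (fun v hv a => ?_) (fun v hv a => ?_)
    · have e : AlgPoints.map (f₂ ≫ f₁) (ptsX.symm (ShimuraSetGS.mk L Jstar τ K v hv a)) =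
          AlgPoints.map f₁ (ptsY.symm (ShimuraSetGS.mk L Jstar τ K v hv (a * 1))) := by
        rw [← hf₂ v hv a, Homeomorph.symm_apply_apply]
        simp only [AlgPoints.map_apply, Category.assoc]
      rw [e, hf₁ v hv (a * 1), mul_assoc]
    · rw [AlgPoints.map_id_apply, Homeomorph.apply_symm_apply, mul_one, mul_one]
  exact ⟨⟨f₁, f₂, h12, h21⟩, fun v hv a => by rw [hf₁ v hv a, mul_one]⟩

end Literature.AlgebraicGeometry.ShimuraVarieties.UnitaryCanonicalModel

end
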